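import Mathlib

/-!
# Four-letter ordered escape ladders from two middle letters (support file)

Item `stmt-MatrixMultiplication-14308` (`FourierTwoFamiliesModP.PrimeTwoFamilies`), line `Sketch`,
ladder language (`LadderLift`).  Companion to the five-letter deficiency bound
(`ladder_pow_three_le_pow_five`): the ASSEMBLY LEMMA behind the explicit four-letter ladders of
deficiency `O(√|G|)`.

Given two direct pairs `(P₁, Q₁)`, `(P₂, Q₂)` ("middle letters"), a point `c` and a finset `U`
(the SEPARATOR) containing `Q₁`, `Q₂`, `c - P₁`, `Q₂ - P₁`, `c`, `c - P₂` and disjoint from the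
two diagonal difference sets `Q₁ - P₁`, `Q₂ - P₂`, the four classes
`X = ({0}, P₁, P₂, c - Uᶜ)`, `Y = (Uᶜ, Q₁, Q₂, {c})`
form an ordered escape ladder of direct classes (`ladder_four_of_two_middle`): every upper cross
difference lies in `U`, every diagonal difference lies outside `U`.  Its co-volumes are
`|G| - |U|, |P₁||Q₁|, |P₂||Q₂|, |G| - |U|`.  With `P₁ = [1,a]`, `Q₁ = (a+1)·[0,b)`,
`P₂ = -a-(a+1)·[1,b]`, `Q₂ = -2a+[0,a)`, `c = -2a-1` in `ZMod M` (`U = Q₁ ∪ [-3a-1,-a-1]`,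
`|U| = b+2a+1`) this is the four-letter ladder of min co-volume `ab` whenever `ab+b+3a+1 ≤ M`
(lead c2 census notes; verified numerically for `M ≤ 49`).
-/

-- single-conjunct summit: the mandated namespace repeats `MatrixMultiplication` (summit = sub-problem).
set_option linter.dupNamespace false

namespace Summit.MatrixMultiplication.MatrixMultiplication.Theorems.PrimeTwoFamilies.LadderLift

open Finset
open scoped Pointwise

/-- **Four-letter ladder from two middle letters.**  See the module docstring. -/
theorem ladder_four_of_two_middle {G : Type*} [AddCommGroup G] [DecidableEq G] [Fintype G]
    (P₁ Q₁ P₂ Q₂ U : Finset G) (c : G)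
    (hW₁ : ∀ x ∈ P₁, ∀ x' ∈ P₁, ∀ y ∈ Q₁, ∀ y' ∈ Q₁, (x - x') + (y - y') = 0 → x = x' ∧ y = y')
    (hW₂ : ∀ x ∈ P₂, ∀ x' ∈ P₂, ∀ y ∈ Q₂, ∀ y' ∈ Q₂, (x - x') + (y - y') = 0 → x = x' ∧ y = y')
    (h₁ : Q₁ ⊆ U) (h₂ : Q₂ ⊆ U) (h₃ : ∀ x ∈ P₁, c - x ∈ U) (h₄ : Q₂ - P₁ ⊆ U) (h₅ : c ∈ U)
    (h₆ : ∀ x ∈ P₂, c - x ∈ U) (hE₁ : Disjoint (Q₁ - P₁) U) (hE₂ : Disjoint (Q₂ - P₂) U)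
    (V : ℕ) (hV₁ : V ≤ P₁.card * Q₁.card) (hV₂ : V ≤ P₂.card * Q₂.card)
    (hVU : V + U.card ≤ Fintype.card G) :
    ∃ X Y : Fin 4 → Finset G,
      (∀ d : Fin 4, ∀ x ∈ X d, ∀ x' ∈ X d, ∀ y ∈ Y d, ∀ y' ∈ Y d,
        (x - x') + (y - y') = 0 → x = x' ∧ y = y') ∧
      (∀ d p q : Fin 4, p < q → ∀ x ∈ X d, ∀ y ∈ Y d, ∀ x' ∈ X p, ∀ y' ∈ Y q, y - x ≠ y' - x') ∧
      ∀ d : Fin 4, V ≤ (X d).card * (Y d).card := by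
  classical
  set Uc : Finset G := univ \ U with hUc
  set PC : Finset G := Uc.image (c - ·) with hPC
  refine ⟨![{0}, P₁, P₂, PC], ![Uc, Q₁, Q₂, {c}], ?_, ?_, ?_⟩
  · -- directness
    intro d
    fin_cases d
    · intro x hx x' hx' y _ y' _ h
      simp only [Fin.zero_eta, Matrix.cons_val_zero, mem_singleton] at hx hx'
      subst hx; subst hx'
      refine ⟨rfl, ?_⟩
      rwa [sub_self, zero_add, sub_eq_zero] at h
    · exact hW₁
    · exact hW₂
    · intro x _ x' _ y hy y' hy' h
      simp only [Fin.reduceFinMk, Matrix.cons_val, mem_singleton] at hy hy'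
      subst hy; subst hy'
      refine ⟨?_, rfl⟩
      rwa [sub_self, add_zero, sub_eq_zero] at h
  · -- ladder clause: diagonal differences avoid `U`, upper cross differences lie in `U`
    have hdiag : ∀ d : Fin 4, ∀ x ∈ (![{0}, P₁, P₂, PC] : Fin 4 → Finset G) d,
        ∀ y ∈ (![Uc, Q₁, Q₂, {c}] : Fin 4 → Finset G) d, y - x ∉ U := by
      intro d
      fin_cases d
      · intro x hx y hy
        simp only [Fin.zero_eta, Matrix.cons_val_zero, mem_singleton] at hx hy
        subst hx
        rw [hUc, mem_sdiff] at hy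
        simpa using hy.2
      · intro x hx y hy
        simp only [Fin.mk_one, Matrix.cons_val_one, Matrix.cons_val_zero] at hx hy
        exact Finset.disjoint_left.1 hE₁ (sub_mem_sub hy hx)
      · intro x hx y hy
        simp only [Fin.reduceFinMk, Matrix.cons_val] at hx hy
        exact Finset.disjoint_left.1 hE₂ (sub_mem_sub hy hx)
      · intro x hx y hy
        simp only [Fin.reduceFinMk, Matrix.cons_val, mem_singleton] at hx hy
        subst hy
        rw [hPC, mem_image] at hx
        obtain ⟨g, hg, rfl⟩ := hx
        rw [hUc, mem_sdiff] at hg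
        simpa using hg.2
    have hcross : ∀ p q : Fin 4, p < q → ∀ x' ∈ (![{0}, P₁, P₂, PC] : Fin 4 → Finset G) p,
        ∀ y' ∈ (![Uc, Q₁, Q₂, {c}] : Fin 4 → Finset G) q, y' - x' ∈ U := by
      intro p q hpq
      fin_cases p <;> fin_cases q <;> simp (config := {decide := true}) at hpq
      · intro x' hx' y' hy'
        simp only [Fin.zero_eta, Matrix.cons_val_zero, mem_singleton, Fin.mk_one,
          Matrix.cons_val_one] at hx' hy'
        subst hx'; rw [sub_zero]; exact h₁ hy'
      · intro x' hx' y' hy'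
        simp only [Fin.zero_eta, Matrix.cons_val_zero, mem_singleton, Fin.reduceFinMk,
          Matrix.cons_val] at hx' hy'
        subst hx'; rw [sub_zero]; exact h₂ hy'
      · intro x' hx' y' hy'
        simp only [Fin.zero_eta, Matrix.cons_val_zero, mem_singleton, Fin.reduceFinMk,
          Matrix.cons_val] at hx' hy'
        subst hx'; subst hy'; rw [sub_zero]; exact h₅
      · intro x' hx' y' hy'
        simp only [Fin.mk_one, Matrix.cons_val_one, Matrix.cons_val_zero, Fin.reduceFinMk,
          Matrix.cons_val] at hx' hy'
        exact h₄ (sub_mem_sub hy' hx')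
      · intro x' hx' y' hy'
        simp only [Fin.mk_one, Matrix.cons_val_one, Matrix.cons_val_zero, Fin.reduceFinMk,
          Matrix.cons_val, mem_singleton] at hx' hy'
        subst hy'; exact h₃ x' hx'
      · intro x' hx' y' hy'
        simp only [Fin.reduceFinMk, Matrix.cons_val, mem_singleton] at hx' hy'
        subst hy'; exact h₆ x' hx'
    intro d p q hpq x hx y hy x' hx' y' hy' he
    exact hdiag d x hx y hy (he ▸ hcross p q hpq x' hx' y' hy')
  · -- co-volumes
    have hUc_card : Uc.card = Fintype.card G - U.card := by
      rw [hUc, card_univ_sdiff]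
    have hPC_card : PC.card = Uc.card := by
      rw [hPC]
      exact card_image_of_injective _ (sub_right_injective)
    intro d
    fin_cases d
    · simp only [Fin.zero_eta, Matrix.cons_val_zero, card_singleton, one_mul]
      rw [hUc_card]; omega
    · exact hV₁
    · exact hV₂
    · simp only [Fin.reduceFinMk, Matrix.cons_val, card_singleton, mul_one]
      rw [hPC_card, hUc_card]; omega

/-! ## The explicit four-letter ladders in `ZMod M` (deficiency `O(√M)`) -/

/-- Casting `ℤ → ZMod M` is injective on differences of absolute value `< M`. -/
private lemma int_eq_of_cast_eq {M : ℕ} {z w : ℤ} (h : (z : ZMod M) = (w : ZMod M))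
    (hlt : |w - z| < (M : ℤ)) : z = w := by
  have hd : (M : ℤ) ∣ w - z := (ZMod.intCast_eq_intCast_iff_dvd_sub z w M).1 h
  have := Int.eq_zero_of_abs_lt_dvd hd hlt
  omega

/-- Multiples of `a+1` indexed by `0 ≤ j < b` stay in `[0, (a+1)b - (a+1)]`. -/
private lemma mul_window {a b j : ℤ} (ha : 0 ≤ a) (h0 : 0 ≤ j) (h1 : j < b) :
    0 ≤ (a + 1) * j ∧ (a + 1) * j ≤ (a + 1) * b - (a + 1) := by
  constructor <;> nlinarith

/-- Multiples of `a+1` indexed by `1 ≤ i ≤ b` stay in `[a+1, (a+1)b]`. -/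
private lemma mul_window' {a b i : ℤ} (ha : 0 ≤ a) (h0 : 1 ≤ i) (h1 : i ≤ b) :
    a + 1 ≤ (a + 1) * i ∧ (a + 1) * i ≤ (a + 1) * b := by
  constructor <;> nlinarith

/-- `(a+1) q - t` with `1 ≤ t ≤ a` is not a multiple of `a+1`. -/
private lemma mul_sub_ne_mul {a q t : ℤ} (ht1 : 1 ≤ t) (ht2 : t ≤ a) (j : ℤ) :
    (a + 1) * q - t ≠ (a + 1) * j := by
  intro h
  have h1 : (a + 1) * (q - j) = t := by linarith
  rcases lt_or_ge j q with hlt | hge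
  · nlinarith
  · nlinarith

/-- `(a+1)(j - j') = t` with `|t| ≤ a` forces `j = j'`. -/
private lemma eq_of_mul_eq {a j j' t : ℤ} (ha : 0 ≤ a) (h : (a + 1) * (j - j') = t)
    (ht1 : -a ≤ t) (ht2 : t ≤ a) : j = j' := by
  rcases lt_trichotomy j j' with hlt | heq | hgt
  · nlinarith
  · exact heq
  · nlinarith

/-- **Explicit four-letter ladders.**  For `1 ≤ a`, `1 ≤ b` and `(a+1) b + 3a + 1 ≤ M` there is an
ordered escape ladder of four direct classes in `ZMod M` all of whose co-volumes are at least `a b`: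
middle letters `P₁ = [1,a]`, `Q₁ = (a+1)·[0,b)`, `P₂ = -a-(a+1)·[1,b]`, `Q₂ = [-2a,-a-1]`, apex point
`c = -2a-1`, separator `U = Q₁ ∪ [-3a-1,-a-1]`, assembled by `ladder_four_of_two_middle`.  With
`a ≈ b ≈ √M` the deficiency `M - ab` is `O(√M)`; by `ladder_pow_three_le_pow_five` no fifth class can
be added at such co-volumes once `M` is large. -/
theorem exists_ladder_four_zmod (M a b : ℕ) (ha : 1 ≤ a) (hb : 1 ≤ b)
    (hM : (a + 1) * b + 3 * a + 1 ≤ M) :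
    ∃ X Y : Fin 4 → Finset (ZMod M),
      (∀ d : Fin 4, ∀ x ∈ X d, ∀ x' ∈ X d, ∀ y ∈ Y d, ∀ y' ∈ Y d,
        (x - x') + (y - y') = 0 → x = x' ∧ y = y') ∧
      (∀ d p q : Fin 4, p < q → ∀ x ∈ X d, ∀ y ∈ Y d, ∀ x' ∈ X p, ∀ y' ∈ Y q, y - x ≠ y' - x') ∧
      ∀ d : Fin 4, a * b ≤ (X d).card * (Y d).card := by
  haveI : NeZero M := ⟨by omega⟩
  -- integer bookkeeping
  have hab : ((a : ℤ) + 1) * b + 3 * a + 1 ≤ M := by exact_mod_cast hM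
  have ha' : (1 : ℤ) ≤ a := by exact_mod_cast ha
  have hb' : (1 : ℤ) ≤ b := by exact_mod_cast hb
  have ha0 : (0 : ℤ) ≤ a := by linarith
  have hMa : 3 * (a : ℤ) + (a + 1) + 1 ≤ M := by nlinarith
  -- the data
  let ic : ℤ → ZMod M := fun z => (z : ZMod M)
  set P₁ : Finset (ZMod M) := (Finset.Icc (1 : ℤ) a).image ic with hP₁
  set Q₁ : Finset (ZMod M) := (Finset.Ico (0 : ℤ) b).image (fun j => ic ((a + 1) * j)) with hQ₁
  set P₂ : Finset (ZMod M) := (Finset.Icc (1 : ℤ) b).image (fun i => ic (-a - (a + 1) * i)) with hP₂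
  set Q₂ : Finset (ZMod M) := (Finset.Ico (-(2 * a) : ℤ) (-a)).image ic with hQ₂
  set I : Finset (ZMod M) := (Finset.Icc (-(3 * a) - 1 : ℤ) (-a - 1)).image ic with hI
  set U : Finset (ZMod M) := Q₁ ∪ I with hU
  set c : ZMod M := ic (-(2 * a) - 1) with hc
  -- membership descriptions
  have memP₁ : ∀ x ∈ P₁, ∃ i : ℤ, 1 ≤ i ∧ i ≤ a ∧ x = ic i := by
    intro x hx
    rw [hP₁, mem_image] at hx
    obtain ⟨i, hi, rfl⟩ := hx
    rw [mem_Icc] at hi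
    exact ⟨i, hi.1, hi.2, rfl⟩
  have memQ₁ : ∀ y ∈ Q₁, ∃ j : ℤ, 0 ≤ j ∧ j < b ∧ y = ic ((a + 1) * j) := by
    intro y hy
    rw [hQ₁, mem_image] at hy
    obtain ⟨j, hj, rfl⟩ := hy
    rw [mem_Ico] at hj
    exact ⟨j, hj.1, hj.2, rfl⟩
  have memP₂ : ∀ x ∈ P₂, ∃ i : ℤ, 1 ≤ i ∧ i ≤ b ∧ x = ic (-a - (a + 1) * i) := by
    intro x hx
    rw [hP₂, mem_image] at hx
    obtain ⟨i, hi, rfl⟩ := hx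
    rw [mem_Icc] at hi
    exact ⟨i, hi.1, hi.2, rfl⟩
  have memQ₂ : ∀ y ∈ Q₂, ∃ s : ℤ, -(2 * a) ≤ s ∧ s < -a ∧ y = ic s := by
    intro y hy
    rw [hQ₂, mem_image] at hy
    obtain ⟨s, hs, rfl⟩ := hy
    rw [mem_Ico] at hs
    exact ⟨s, hs.1, hs.2, rfl⟩
  have memI : ∀ t : ℤ, -(3 * a) - 1 ≤ t → t ≤ -a - 1 → ic t ∈ I := by
    intro t ht1 ht2
    rw [hI, mem_image]
    exact ⟨t, mem_Icc.2 ⟨ht1, ht2⟩, rfl⟩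
  have memI' : ∀ u ∈ I, ∃ t : ℤ, -(3 * a) - 1 ≤ t ∧ t ≤ -a - 1 ∧ u = ic t := by
    intro u hu
    rw [hI, mem_image] at hu
    obtain ⟨t, ht, rfl⟩ := hu
    rw [mem_Icc] at ht
    exact ⟨t, ht.1, ht.2, rfl⟩
  have memQ₁' : ∀ j : ℤ, 0 ≤ j → j < b → ic ((a + 1) * j) ∈ Q₁ := by
    intro j hj1 hj2
    rw [hQ₁, mem_image]
    exact ⟨j, mem_Ico.2 ⟨hj1, hj2⟩, rfl⟩
  have icsub : ∀ z w : ℤ, ic z - ic w = ic (z - w) := by intro z w; simp [ic]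
  -- an integer `e` of the window `[-a, (a+1)b)` that is no multiple `(a+1)j`, `0 ≤ j < b`, is cast
  -- outside `U`
  have notQ₁ : ∀ e : ℤ, (∀ j : ℤ, e ≠ (a + 1) * j) → -a ≤ e → e < (a + 1) * b → ic e ∉ Q₁ := by
    intro e he he1 he2 hmem
    obtain ⟨j, hj1, hj2, hj⟩ := memQ₁ _ hmem
    obtain ⟨hj3, hj4⟩ := mul_window ha0 hj1 hj2
    exact he j (int_eq_of_cast_eq hj (by rw [abs_lt]; constructor <;> linarith))
  have notI : ∀ e : ℤ, -a ≤ e → e < (a + 1) * b → ic e ∉ I := by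
    intro e he1 he2 hmem
    obtain ⟨t, ht1, ht2, ht⟩ := memI' _ hmem
    have h := int_eq_of_cast_eq ht (by rw [abs_lt]; constructor <;> linarith)
    linarith
  have notU : ∀ e : ℤ, (∀ j : ℤ, e ≠ (a + 1) * j) → -a ≤ e → e < (a + 1) * b → ic e ∉ U := by
    intro e he he1 he2 hmem
    rw [hU, mem_union] at hmem
    rcases hmem with h | h
    · exact notQ₁ e he he1 he2 h
    · exact notI e he1 he2 h
  -- the eight hypotheses of the assembly lemma
  have HW₁ : ∀ x ∈ P₁, ∀ x' ∈ P₁, ∀ y ∈ Q₁, ∀ y' ∈ Q₁,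
      (x - x') + (y - y') = 0 → x = x' ∧ y = y' := by
    intro x hx x' hx' y hy y' hy' h
    obtain ⟨i, hi1, hi2, rfl⟩ := memP₁ x hx
    obtain ⟨i', hi1', hi2', rfl⟩ := memP₁ x' hx'
    obtain ⟨j, hj1, hj2, rfl⟩ := memQ₁ y hy
    obtain ⟨j', hj1', hj2', rfl⟩ := memQ₁ y' hy'
    obtain ⟨hj3, hj4⟩ := mul_window ha0 hj1 hj2
    obtain ⟨hj3', hj4'⟩ := mul_window ha0 hj1' hj2'
    have h0 : ic ((i - i') + ((a + 1) * j - (a + 1) * j')) = ic 0 := by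
      simpa [ic] using h
    have h1 := int_eq_of_cast_eq h0 (by rw [abs_lt]; constructor <;> linarith)
    have hj : j = j' := eq_of_mul_eq ha0 (show ((a : ℤ) + 1) * (j - j') = i' - i by linarith)
      (by linarith) (by linarith)
    subst hj
    have hi : i = i' := by linarith
    subst hi
    exact ⟨rfl, rfl⟩
  have HW₂ : ∀ x ∈ P₂, ∀ x' ∈ P₂, ∀ y ∈ Q₂, ∀ y' ∈ Q₂,
      (x - x') + (y - y') = 0 → x = x' ∧ y = y' := by
    intro x hx x' hx' y hy y' hy' h
    obtain ⟨i, hi1, hi2, rfl⟩ := memP₂ x hx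
    obtain ⟨i', hi1', hi2', rfl⟩ := memP₂ x' hx'
    obtain ⟨s, hs1, hs2, rfl⟩ := memQ₂ y hy
    obtain ⟨s', hs1', hs2', rfl⟩ := memQ₂ y' hy'
    obtain ⟨hi3, hi4⟩ := mul_window' ha0 hi1 hi2
    obtain ⟨hi3', hi4'⟩ := mul_window' ha0 hi1' hi2'
    have h0 : ic ((-a - (a + 1) * i - (-a - (a + 1) * i')) + (s - s')) = ic 0 := by
      simpa [ic] using h
    have h1 := int_eq_of_cast_eq h0 (by rw [abs_lt]; constructor <;> linarith)
    have hi : i' = i := eq_of_mul_eq ha0 (show ((a : ℤ) + 1) * (i' - i) = s' - s by linarith)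
      (by linarith) (by linarith)
    subst hi
    have hs : s = s' := by linarith
    subst hs
    exact ⟨rfl, rfl⟩
  have H₂ : Q₂ ⊆ U := by
    intro y hy
    obtain ⟨s, hs1, hs2, rfl⟩ := memQ₂ y hy
    rw [hU]; exact mem_union_right _ (memI s (by linarith) (by linarith))
  have H₃ : ∀ x ∈ P₁, c - x ∈ U := by
    intro x hx
    obtain ⟨i, hi1, hi2, rfl⟩ := memP₁ x hx
    rw [hc, icsub, hU]
    exact mem_union_right _ (memI _ (by linarith) (by linarith))
  have H₄ : Q₂ - P₁ ⊆ U := by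
    intro d hd
    rw [mem_sub] at hd
    obtain ⟨y, hy, x, hx, rfl⟩ := hd
    obtain ⟨s, hs1, hs2, rfl⟩ := memQ₂ y hy
    obtain ⟨i, hi1, hi2, rfl⟩ := memP₁ x hx
    rw [icsub, hU]
    exact mem_union_right _ (memI _ (by linarith) (by linarith))
  have H₅ : c ∈ U := by
    rw [hc, hU]; exact mem_union_right _ (memI _ (by linarith) (by linarith))
  have H₆ : ∀ x ∈ P₂, c - x ∈ U := by
    intro x hx
    obtain ⟨i, hi1, hi2, rfl⟩ := memP₂ x hx
    rw [hc, icsub, hU]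
    refine mem_union_left _ ?_
    have : (-(2 * (a : ℤ)) - 1 - (-a - (a + 1) * i)) = (a + 1) * (i - 1) := by ring
    rw [this]
    exact memQ₁' (i - 1) (by linarith) (by linarith)
  have HE₁ : Disjoint (Q₁ - P₁) U := by
    rw [Finset.disjoint_left]
    intro d hd
    rw [mem_sub] at hd
    obtain ⟨y, hy, x, hx, rfl⟩ := hd
    obtain ⟨j, hj1, hj2, rfl⟩ := memQ₁ y hy
    obtain ⟨i, hi1, hi2, rfl⟩ := memP₁ x hx
    obtain ⟨hj3, hj4⟩ := mul_window ha0 hj1 hj2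
    rw [icsub]
    exact notU _ (mul_sub_ne_mul hi1 hi2) (by linarith) (by linarith)
  have HE₂ : Disjoint (Q₂ - P₂) U := by
    rw [Finset.disjoint_left]
    intro d hd
    rw [mem_sub] at hd
    obtain ⟨y, hy, x, hx, rfl⟩ := hd
    obtain ⟨s, hs1, hs2, rfl⟩ := memQ₂ y hy
    obtain ⟨i, hi1, hi2, rfl⟩ := memP₂ x hx
    obtain ⟨hi3, hi4⟩ := mul_window' ha0 hi1 hi2
    rw [icsub]
    have : s - (-(a : ℤ) - (a + 1) * i) = (a + 1) * i - (-s - a) := by ring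
    rw [this]
    exact notU _ (mul_sub_ne_mul (by linarith) (by linarith)) (by linarith) (by linarith)
  -- cardinalities
  have hcP₁ : P₁.card = a := by
    rw [hP₁, card_image_of_injOn, Int.card_Icc]
    · simp
    intro i hi i' hi' h
    rw [coe_Icc, Set.mem_Icc] at hi hi'
    exact int_eq_of_cast_eq h (by rw [abs_lt]; constructor <;> linarith)
  have hcQ₁ : Q₁.card = b := by
    rw [hQ₁, card_image_of_injOn, Int.card_Ico]
    · simp
    intro j hj j' hj' h
    rw [coe_Ico, Set.mem_Ico] at hj hj'
    obtain ⟨hj3, hj4⟩ := mul_window ha0 hj.1 hj.2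
    obtain ⟨hj3', hj4'⟩ := mul_window ha0 hj'.1 hj'.2
    have h1 := int_eq_of_cast_eq h (by rw [abs_lt]; constructor <;> linarith)
    exact eq_of_mul_eq ha0 (show ((a : ℤ) + 1) * (j - j') = 0 by linarith) (by linarith) ha0
  have hcP₂ : P₂.card = b := by
    rw [hP₂, card_image_of_injOn, Int.card_Icc]
    · simp
    intro i hi i' hi' h
    rw [coe_Icc, Set.mem_Icc] at hi hi'
    obtain ⟨hi3, hi4⟩ := mul_window' ha0 hi.1 hi.2
    obtain ⟨hi3', hi4'⟩ := mul_window' ha0 hi'.1 hi'.2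
    have h1 := int_eq_of_cast_eq h (by rw [abs_lt]; constructor <;> linarith)
    exact eq_of_mul_eq ha0 (show ((a : ℤ) + 1) * (i - i') = 0 by linarith) (by linarith) ha0
  have hcQ₂ : Q₂.card = a := by
    rw [hQ₂, card_image_of_injOn, Int.card_Ico]
    · simp only [sub_neg_eq_add]
      omega
    intro s hs s' hs' h
    rw [coe_Ico, Set.mem_Ico] at hs hs'
    exact int_eq_of_cast_eq h (by rw [abs_lt]; constructor <;> linarith)
  have hU' : U.card ≤ b + (2 * a + 1) := by
    rw [hU]
    refine (card_union_le _ _).trans (Nat.add_le_add ?_ ?_)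
    · rw [hQ₁]; refine card_image_le.trans ?_; rw [Int.card_Ico]; simp
    · rw [hI]; refine card_image_le.trans ?_; rw [Int.card_Icc]; omega
  have HVU : a * b + U.card ≤ Fintype.card (ZMod M) := by
    rw [ZMod.card]
    nlinarith
  obtain ⟨X, Y, hW, hL, hV⟩ := ladder_four_of_two_middle P₁ Q₁ P₂ Q₂ U c HW₁ HW₂
    (by rw [hU]; exact subset_union_left) H₂ H₃ H₄ H₅ H₆ HE₁ HE₂ (a * b)
    (by rw [hcP₁, hcQ₁]) (by rw [hcP₂, hcQ₂, mul_comm]) HVU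
  exact ⟨X, Y, hW, hL, hV⟩

end Summit.MatrixMultiplication.MatrixMultiplication.Theorems.PrimeTwoFamilies.LadderLift
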